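import Summits.QuantumFields.YangMills.Theses.UnitScaleTilt
import Summits.QuantumFields.YangMills.Theorems.UnitScaleTiltHistoryTailLaneTail
import Summits.QuantumFields.YangMills.Theorems.UnitScaleTiltHistoryTailLaneTailInt
import Summits.QuantumFields.YangMills.Theorems.UnitScaleTiltHistoryTailLaneTailOldRec

/-!
# LINE «PinnedStability» v5 CANDIDATE — ONE-ROW DISPLAY of the 19936 skeleton (crux stmt-QuantumFields-19936 `UnitScaleTilt.HistoryTailL`):
# the (α) organ row ALONE already closes the crux in the tree; v4's displayed row `stub_hJ` is REDUNDANT for 19936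

Seat ym-r3-idea-2 g17 (lens «nearmiss»), 2026-08-30.  CANDIDATE ONLY — NOT registered: a registry verb on 19936 needs an ★★OWNER word + a RULING №36
pre-announcement (WORD 76 (c)); this file is published organ-level (`Lines/…`, №36 (3)) as the certificate behind the FINDING posted on the bus.
HONEST: nothing of `HistoryTailL` (19936), of R3 (YM₃ on T³ — NOT d = 4, NOT infinite volume, NOT a mass gap, NOT Clay) is proved here; no summit is proved by a line.

MEASURED DEFICIT (the near miss, kernel-certified): the skeleton of record v4 (`Lines/pinned_stability.lean` 5c1d520be98cfc97) displays TWO rows,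
`stub_laneRecordsV3` (87 ch, the (α) LANE RECORDS `AlphaInputsT3ACv3Rec L` for odd `L > 1`) and `stub_hJ` (541 ch, the K-uniform a.e. MASS ENVELOPE of the pinned
transported history masses).  But the tree ALREADY proves `HistoryTailL` from the FIRST row ALONE, BY ONE NAME, since 2026-08-27T09:37Z (fleet lead ym-ust-18916-p1 g5, the sorry-free cone of
skeleton v5p7; `--supports` 19936):
  `HistoryTailLaneTail.historyTailL_of_laneRecords (hrec : ∀ L : ℕ, Odd L → 1 < L → AlphaInputsT3ACv3Rec L) : Theses.UnitScaleTilt.HistoryTailL`   (`Theorems/UnitScaleTiltHistoryTailLaneTail.lean` l.245)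
and again by the p2 g16 core-family engine landed 2026-08-27T21:2xZ (R-57; the v5p9 ∕ v5p10 skeletons of 2026-08-27∕28 had exactly this one-row shape):
  `HistoryTailLaneTailOldRec.intCoreRec_of_laneRecords (L) (h : AlphaInputsT3ACv3Rec L) : AlphaInputsT3AC.IntCoreRec L`      (`Theorems/UnitScaleTiltHistoryTailLaneTailOldRec.lean` l.73)
  `HistoryTailLaneTailInt.historyTailL_of_intCoreRec (hrec : ∀ L, Odd L → 1 < L → AlphaInputsT3AC.IntCoreRec L) : HistoryTailL`   (`Theorems/UnitScaleTiltHistoryTailLaneTailInt.lean` l.251)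
— an INTEGRATED route (Mechanism A `setIntegral_up_le` + the unconditional `∫ wtP ≤ 1` of `MassesPAC.integral_massRecP_le_one` ∕ `PinnedStep.integrable_wtP_and_integral_le`,
termwise deterministic small factors, the (L)-half at the mean), which never needs a POINTWISE envelope of the pinned masses; the v4 route (K-19 socket → Z-level S∕U faces →
w6 g7's organ `OfV3At.hSii_of_massEnvelope (hJ)`) re-derives the tail through a.e. DENSITIES and thereby CREATES the need for hJ.  Hence, GIVEN the organ row, hJ carries no
content toward 19936: closing `stub_hJ` closes nothing that `stub_laneRecordsV3` alone does not already close.  (The Jacobian ∕ N08 content is real — but it sits BELOW the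
organ in the DAG: it is an input to SUPPLYING the (α) record's (47)∕(55) rows for the tree's guarded, non-Haar-compatible averaging `avT3` (R-57χ header of
`Theorems/AlphaInputsT3ACv3Chi.lean`; dag-n08-d), not a row BESIDE the record.)  The same one-row closer exists in the other record currencies:
`HistoryTailLaneTailChi.intCoreRec_of_laneRecordsChi` (`AlphaInputsT3ACv3RecChi`) and `historyTailL_of_intCoreRecRows ∘ intCoreRecRows_of_laneRecordsV4Chi` (`AlphaInputsT3ACv4RecChi`).
* §1 `stub_laneRecordsV3` — VERBATIM the registered 87-char text (ws-sha16 477e6b4bfeca14ee), the ONLY `sorry`.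
* §2 `HistoryTailL_of_stubs` — the UNIQUE local theorem concluding the crux BY NAME with zero extra hypotheses (★★OWNER RULING №39), := `historyTailL_of_laneRecords` applied to §1
  (p2 g16's composition is recorded in the docstring as the twin; both elaborate, farm rc 0).
WHERE hJ IS LOAD-BEARING (so nobody reads this as «N08 is moot»): relative to a ONE-PROFILE package socket (the faces' `hpkg : … ∃ 𝔠 a₀ a₁, OfV3At F 𝔠 a₀ a₁ ∧ …` at one
profile) `{hpkg, hJ} ⇒ HistoryTailL` by v4's §1a–§4 and neither alone does (cheaply); but the registry displays the ∀-profile RECORD (print supplies all large profiles anyway,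
[Balaban1985UV3] Thm 2), and relative to the record hJ is implied.  The Jacobian content belongs to the SUPPLY of the record for the guarded averaging — the UV3 node.
[cite: Balaban1985UV3, Thm 2 p.272 and (38)-(47) pp.266-267; Balaban1985Variational, Thm 1 (8) p.279; King1986, (3.12)]
-/

namespace Summit.QuantumFields.YangMills.Cruxes.HistoryTailL.PinnedStability

/-! ## §1 The ONE registered row — the (α) organ, by the cell's established name and text -/

/-- stub (XXL · THE ORGAN, registered ONCE, BY THE CELL'S ESTABLISHED NAME AND TEXT): the (α) LANE RECORDS, version 3 — for every odd block size
`L > 1` the record-parametric closed proposition `AlphaInputsT3ACv3Rec L` (`∃ b₁ p₁, ∀ b₀ p₀ ⪰, ∃ 𝔠 a₀ a₁, 𝔠.b₀ = b₀ ∧ 𝔠.p₀ = p₀ ∧ … ∧ ∀ F, F.L = L → OfV3At F 𝔠 a₀ a₁`):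
Bałaban's inductive small-∕large-field bounds (38)–(47) with the AC tower for SU(2) `T³` families — the pub-balaban3d lane's target.  VERBATIM the text of
`stub_laneRecordsV3` of the `FluctuationComparisonRegPrL` lineage (`Cruxes/FluctuationComparisonRegPrL/Lines/birth_v5j4.lean`) and of v4, so ONE supplier theorem
closes every row wanting it with `--supports`.  WHY IT MIGHT FAIL: it is the content of [Balaban1985UV3] Thm 2 + [Balaban1985Variational] Thm 1 + [Balaban1988Convergent]
for pure YM₃ at the tree's V3 interface (pinned masses, (40) windows inside the rows) FOR THE TREE'S GUARDED AVERAGING (the (47)∕(55) rows at the trivial history carry the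
Jacobian ∕ N08 content); the interface is the lane's moving frontier (`…v3RecChi`, `…v4RecChi` exist).
[cite: Balaban1985UV3, Thm 2 p.272 and (38)-(47) pp.266-267; Balaban1985Variational, Thm 1 (8) p.279] -/
theorem stub_laneRecordsV3 : ∀ L : ℕ, Odd L → 1 < L → Summit.QuantumFields.YangMills.Theorems.AlphaInputsT3ACv3Rec L := by
  sorry

/-! ## §2 The crux BY NAME — the UNIQUE local concluder (★★OWNER RULING №39: zero extra hypotheses) -/

/-- **`UnitScaleTilt.HistoryTailL` FROM THE ONE REGISTERED ROW** `stub_laneRecordsV3`, BY ONE NAME: p1 g5's `HistoryTailLaneTail.historyTailL_of_laneRecords`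
(in the tree since 2026-08-27).  Twin (also elaborates, farm rc 0): `HistoryTailLaneTailInt.historyTailL_of_intCoreRec (fun L hO hL =>
HistoryTailLaneTailOldRec.intCoreRec_of_laneRecords L (stub_laneRecordsV3 L hO hL))`.  CONDITIONAL on the one sorried row; nothing of the crux is proved. -/
theorem HistoryTailL_of_stubs : Summit.QuantumFields.YangMills.Theses.UnitScaleTilt.HistoryTailL :=
  Summit.QuantumFields.YangMills.Theorems.HistoryTailLaneTail.historyTailL_of_laneRecords stub_laneRecordsV3

/-- The twin concluder through p2 g16's integrated core-family engine (R-57) — an `example`, so the file keeps exactly ONE local theorem concluding the crux (RULING №39). -/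
example : Summit.QuantumFields.YangMills.Theses.UnitScaleTilt.HistoryTailL :=
  Summit.QuantumFields.YangMills.Theorems.HistoryTailLaneTailInt.historyTailL_of_intCoreRec
    (fun L hO hL => Summit.QuantumFields.YangMills.Theorems.HistoryTailLaneTailOldRec.intCoreRec_of_laneRecords L (stub_laneRecordsV3 L hO hL))

end Summit.QuantumFields.YangMills.Cruxes.HistoryTailL.PinnedStability
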